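import Summits.SmoothPoincare4.SmoothPoincare4.Theses.RootDecompU

/-!
# RootDecompU — glue of the split «DescentDepth» of `RSublinkDescent`

Proves the glue item `RSublinkDescentGlue` (stmt-SmoothPoincare4-29672, support, rank 303) of
route-SmoothPoincare4-RootDecompU:
`ShallowDescent → DeepDescent → RSublinkDescent`
(stmt-SmoothPoincare4-29670 → 29671 → 29651).

Pure logic (excluded middle on the depth guard `n ≤ 1 ∨ b ≤ 1` of the sublink `L ⊂ L'` with `n` kept and `b` deleted
components; its negation is `2 ≤ n ∧ 2 ≤ b`, the guard of `DeepDescent`). Root decomposition cell decomp-sp4 (D-0178),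
LANDING LIST 2 (writer g6); 0 sorry. Nothing here proves `SmoothPoincare4`.
-/

set_option linter.dupNamespace false

namespace Summit.SmoothPoincare4.SmoothPoincare4.Theorems.RootDecompURSublinkDescentSplit

open Summit.SmoothPoincare4.SmoothPoincare4.Theses.RootDecompU

/-- Item stmt-SmoothPoincare4-29672: the shallow and deep descent cells re-assemble the parent `RSublinkDescent`. -/
theorem rSublinkDescentGlue_holds : RSublinkDescentGlue := by
  intro hS hD n b L L' hpre M' _ _ _ _ _ hM' hstd M _ _ _ _ _ hM
  by_cases h : n ≤ 1 ∨ b ≤ 1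
  · exact hS n b h L L' hpre M' hM' hstd M hM
  · exact hD n b (by omega) (by omega) L L' hpre M' hM' hstd M hM

end Summit.SmoothPoincare4.SmoothPoincare4.Theorems.RootDecompURSublinkDescentSplit
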